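import Literature.Analysis.Complex.DolbeaultVanishing
import Literature.Analysis.Complex.DbarExhaustion
import Literature.Analysis.Complex.ConvexExhaustion
import Literature.Analysis.Complex.OkaAnalyticPolyhedron
import Literature.Analysis.Complex.PolydiscApprox
import Literature.Analysis.Complex.PQTypeZeroHolomorphic
import HarnessLib

/-!
# The `∂̄`-Poincaré lemma on convex open sets (discharge of `subsingleton_dolbeaultCohomology_of_convex`)

**Theorem** (`subsingleton_dolbeaultCohomology_of_convex_holds`, the named fact
`Literature.NumberTheory.Transcendental.subsingleton_dolbeaultCohomology_of_convex` of
`Literature/NumberTheory/Transcendental/Dolbeault.lean`). For a convex open subset `U` of a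
finite-dimensional complex normed space `E` and all `p, q`, the Dolbeault cohomology
`H^{p,q+1}_{∂̄}(U)` of the open submanifold `U` vanishes: every smooth `∂̄`-closed `(p,q+1)`-form on
`U` is `∂̄` of a smooth `(p,q)`-form on `U`.

The proof is Hörmander's elementary one (*An Introduction to Complex Analysis in Several
Variables* (1973), Ch. II), assembled from the flat `(p,q)`-calculus of
`Literature/Analysis/Complex/`:

1. `entireApprox_analyticPolyhedron` (private) — **Oka–Weil approximation** (Thm. 2.7.7 via
   Thm. 2.7.6 (b)): a function holomorphic near an analytic polyhedron
   `K = {z ∈ Δ̄(c,r) : |P_j z| ≤ 1}` (`P_j` entire) is a uniform limit on `K` of entire functions —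
   induction on the number of functions through `ℂ^{Option ι}`: for a closed polydisc this is
   Taylor approximation (`exists_entire_approx_on_closedPolydisc`, Thm. 2.2.6); in the inductive
   step Oka's transfer `oka_transfer` (Lemma 2.7.5 in bidegree `(0,0) → (0,1)`, fed with the
   solvability theorem `exists_dbar_potential_nhds_analyticPolyhedron`, Thm. 2.7.6 (a)) gives `F₂`
   holomorphic near the lifted polyhedron with `F₂(z, P(z)) = f(z)` near `K`, which is approximated
   by induction and pulled back along the graph of `P`;
2. `exists_dbar_potential_of_convex` — **Hörmander's Thm. 2.7.8 for convex open `Ω ⊆ ℂ^ι`**: the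
   abstract exhaustion theorem `exists_dbar_potential_of_compactExhaustion` (`DbarExhaustion.lean`,
   Thm. 2.7.8) applied to the exhaustion of `Ω` by compact AFFINE polyhedra
   `K_j = {z ∈ Δ̄ : |L_l z + b_l| ≤ 1}` (`exists_affinePolyhedron_exhaustion`,
   `ConvexExhaustion.lean`, the convex case of Lemma 2.7.4), whose two hypotheses are Oka's theorem
   `exists_dbar_potential_nhdsSet_analyticPolyhedron` (`OkaAnalyticPolyhedron.lean`, Lemma 2.7.5 /
   Thm. 2.7.6 (a), resting on the polydisc lemma Thm. 2.3.3 of `PQFlatPoincare.lean`) and step 1;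
3. `subsingleton_dolbeaultCohomology_of_convex_pi` — the case `E = ℂ^ι`, through
   `subsingleton_dolbeaultCohomology_of_flatDbarSolver` (`DolbeaultVanishing.lean`: transport
   between the tree's forms on the open submanifold `U` and flat forms on `ℂ^ι`, `OpensFlat.lean`);
4. `subsingleton_dolbeaultCohomology_of_convex_holds` — a general finite-dimensional `E` is
   `ℂ`-linearly homeomorphic to `ℂⁿ` (`ContinuousLinearEquiv.ofFinrankEq`), convexity is
   preserved, and the Dolbeault cohomology of corresponding open sets is transported by
   `subsingleton_dolbeaultCohomology_of_equiv_preimage` (`DolbeaultVanishing.lean`, functoriality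
   of `∂̄` under biholomorphisms, `DolbeaultInvariance.lean`).

Hörmander states the result for pseudoconvex `Ω` (Cor. 4.2.6, by `L²` estimates) and, in the
elementary Ch. II form used here, for `Ω` exhausted by compacta `K` with `K̂_Ω = K` (Thm. 2.7.8);
for convex `Ω` the hulls of convex compacta are cut out by affine functions (loc. cit., p. 40),
which is what `ConvexExhaustion.lean` formalises. The tree's docstring cites Voisin (2002),
Prop. 2.36 (the local statement) and Hörmander, Cor. 4.2.6.

## References

* L. Hörmander, *An Introduction to Complex Analysis in Several Variables*, 2nd ed. (1973),
  Thm. 2.2.6, Thm. 2.3.3, Lemma 2.7.4, Lemma 2.7.5, Thm. 2.7.6, Thm. 2.7.7, Thm. 2.7.8,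
  Cor. 4.2.6. [HormanderSCV1973]
* C. Voisin, *Hodge Theory and Complex Algebraic Geometry I* (2002), Prop. 2.31, Prop. 2.36.
  [Voisin2002]
-/

noncomputable section

open scoped Manifold ContDiff Topology
open Complex Function Set Filter Metric ContinuousAlternatingMap
open Literature.Analysis.Complex Literature.LinearAlgebra.Alternating

namespace Literature.NumberTheory.Transcendental

universe u

/-! ### Functions as `0`-forms -/

section ZeroForms

variable {E : Type*} [NormedAddCommGroup E] [NormedSpace ℝ E]

/-- A `0`-form value is constant on the (unique) empty tuple. [folklore] -/
private theorem apply_eq_apply_zero_of_fin_zero (η : E [⋀^Fin 0]→L[ℝ] ℂ) (v : Fin 0 → E) : η v = η 0 :=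
  congr_arg η (Subsingleton.elim _ _)

/-- The `0`-form value with constant value `a` evaluates to `a`. [folklore] -/
private theorem smul_constOfIsEmpty_one_apply (a : ℂ) (v : Fin 0 → E) :
    (a • ContinuousAlternatingMap.constOfIsEmpty ℝ E (Fin 0) (1 : ℂ)) v = a := by
  rw [ContinuousAlternatingMap.smul_apply, ContinuousAlternatingMap.constOfIsEmpty_apply, smul_eq_mul,
    mul_one]

end ZeroForms

section ZeroFormsComplex

variable {E : Type*} [NormedAddCommGroup E] [NormedSpace ℂ E]

/-- Every `0`-form value has type `(0,0)`. [folklore] -/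
private theorem isOfTypeAt_zero_zero (η : E [⋀^Fin 0]→L[ℝ] ℂ) : IsOfTypeAt 0 0 η :=
  ⟨rfl, fun θ v => by
    rw [Subsingleton.elim (fun i => exp (θ * I) • v i) v]
    simp⟩

/-- Evaluation of form-valued maps at a fixed tuple preserves complex differentiability (the
evaluation is complex-linear and continuous). [folklore] -/
private theorem alternatingMap_apply_const {X : Type*} [NormedAddCommGroup X] [NormedSpace ℂ X]
    {k : ℕ} {F : X → E [⋀^Fin k]→L[ℝ] ℂ} {U : Set X} (hF : DifferentiableOn ℂ F U) (v : Fin k → E) :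
    DifferentiableOn ℂ (fun y => F y v) U := by
  let ev : (E [⋀^Fin k]→L[ℝ] ℂ) →L[ℂ] ℂ :=
    { toFun := fun η => η v
      map_add' := fun _ _ => rfl
      map_smul' := fun _ _ => rfl
      cont := (ContinuousAlternatingMap.apply ℝ E ℂ v).continuous }
  exact ev.differentiable.comp_differentiableOn hF

end ZeroFormsComplex

/-! ### Oka–Weil approximation on analytic polyhedra (Hörmander, Thm. 2.7.7) -/

/-- **Oka–Weil approximation on analytic polyhedra** (Hörmander (1973), Thm. 2.7.7 with
Thm. 2.7.6 (b), for polyhedra `K = {z ∈ Δ̄(c,r) : |P_j z| ≤ 1}` of entire functions): a function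
holomorphic on an open neighbourhood of `K` is, on `K`, a uniform limit of entire functions.
[cite: HormanderSCV1973, Thm. 2.7.7] -/
private theorem entireApprox_analyticPolyhedron :
    ∀ (m : ℕ) {ι : Type u} [Fintype ι] [DecidableEq ι] (c : ι → ℂ) (r : ι → ℝ)
      (P : Fin m → (ι → ℂ) → ℂ) (_hP : ∀ j, Differentiable ℂ (P j)) {U : Set (ι → ℂ)}
      (_hU : IsOpen U) (_hKU : analyticPolyhedron c r P ⊆ U) {f : (ι → ℂ) → ℂ}
      (_hf : DifferentiableOn ℂ f U) {ε : ℝ} (_hε : 0 < ε),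
      ∃ g : (ι → ℂ) → ℂ, Differentiable ℂ g ∧ ∀ z ∈ analyticPolyhedron c r P, ‖f z - g z‖ ≤ ε := by
  intro m
  induction m with
  | zero =>
    intro ι _ _ c r P hP U hU hKU f hf ε hε
    rw [analyticPolyhedron_zero] at hKU ⊢
    by_cases hr : ∀ i, 0 ≤ r i
    · obtain ⟨δ, hδ, hδU⟩ := exists_polydisc_between hr hU hKU
      obtain ⟨g, hg, hgf⟩ := exists_entire_approx_on_closedPolydisc (t := r) (hf.mono hδU)
        (fun i => show r i < r i + δ from lt_add_of_pos_right _ hδ) hε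
      exact ⟨g, hg, hgf⟩
    · obtain ⟨i, hi⟩ := not_forall.1 hr
      refine ⟨0, differentiable_const 0, fun z hz => absurd ?_ hi⟩
      exact (norm_nonneg _).trans (mem_closedPolydisc.1 hz i)
  | succ m ih =>
    intro ι _ _ c r P hP U hU hKU f hf ε hε
    set K : Set (ι → ℂ) := analyticPolyhedron c r P with hK_def
    have hKc : IsCompact K := isCompact_analyticPolyhedron c r fun j => (hP j).continuous
    -- cut-off and the `0`-form `F₁ = χ f`
    obtain ⟨χ, hχs, -, hχU, O, hOo, hKO, hO1⟩ := exists_complex_cutoff_nhdsSet hKc hU hKU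
    set O' : Set (ι → ℂ) := O ∩ U with hO'_def
    have hO'o : IsOpen O' := hOo.inter hU
    have hKO' : K ⊆ O' := subset_inter hKO hKU
    set η₁ : (ι → ℂ) [⋀^Fin 0]→L[ℝ] ℂ :=
      ContinuousAlternatingMap.constOfIsEmpty ℝ (ι → ℂ) (Fin 0) (1 : ℂ) with hη₁
    set f0 : (ι → ℂ) → (ι → ℂ) [⋀^Fin 0]→L[ℝ] ℂ := fun x => f x • η₁ with hf0_def
    have hf0 : DifferentiableOn ℂ f0 U := hf.smul_const η₁
    have hfs : ContDiffOn ℝ ∞ f U := contDiffOn_real_of_differentiableOn hf hU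
    have hf0s : ContDiffOn ℝ ∞ f0 U := hfs.smul_const η₁
    set F₁ : (ι → ℂ) → (ι → ℂ) [⋀^Fin 0]→L[ℝ] ℂ := fun x => χ x • f0 x with hF₁_def
    have hF₁s : ContDiff ℝ ∞ F₁ := contDiff_smul_of_tsupport_subset hU hχs hχU hf0s
    have hF₁t : ∀ x, IsOfTypeAt 0 0 (F₁ x) := fun x => isOfTypeAt_zero_zero _
    have hF₁f : ∀ x ∈ O', F₁ x = f0 x := fun x hx => by
      simp only [hF₁_def, hO1 x hx.1, one_smul]
    have hGO : ∀ x ∈ O', typeProjAt 0 (0 + 1) (extDeriv F₁ x) = 0 := by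
      intro x hx
      rw [(Filter.eventuallyEq_of_mem (hO'o.mem_nhds hx) hF₁f).extDeriv_eq,
        typeProjAt_extDeriv_eq_sum (fun y => isOfTypeAt_zero_zero (f0 y))]
      refine Finset.sum_eq_zero fun j _ => ?_
      rw [dbarAlong_eq_zero_of_differentiableAt (hf0.differentiableAt (hU.mem_nhds hx.2)), wedgeOne_zero]
    -- Oka's transfer in bidegree `(0,0) → (0,1)`, with the solvability theorem on `ℂ^{Option ι}`
    have hPo : ∀ j, Differentiable ℂ (optFun P j) := differentiable_optFun hP
    obtain ⟨U₁, hU₁o, hKoU₁, F₂, hF₂s, hF₂t, hF₂c, hF₂F₁⟩ :=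
      oka_transfer c r P hP (N := 0) (p := 0) (s := 0) rfl
        (fun {W} hWo hKoW {g} hgs hgt hgc =>
          exists_dbar_potential_nhds_analyticPolyhedron m (optCentre c) (optRadius r) (optFun P) hPo
            hWo hKoW hgs hgt hgc)
        hF₁s hF₁t hO'o hKO' hGO
    -- `F₂` is holomorphic near `K₊`; approximate it there by induction
    have hF₂h : DifferentiableOn ℂ F₂ U₁ :=
      differentiableOn_complex_of_typeZero hU₁o (hF₂s.differentiableOn (by simp)) hF₂t hF₂c
    set f₂ : (Option ι → ℂ) → ℂ := fun y => F₂ y 0 with hf₂_def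
    have hf₂ : DifferentiableOn ℂ f₂ U₁ := alternatingMap_apply_const hF₂h 0
    obtain ⟨φ, hφ, hφf⟩ := ih (optCentre c) (optRadius r) (optFun P) hPo hU₁o hKoU₁ hf₂ hε
    -- pull back along the graph
    set Pl : (ι → ℂ) → ℂ := P (Fin.last m) with hPl_def
    refine ⟨fun z => φ (optEmbed Pl z), hφ.comp (differentiable_optEmbed (hP _)), fun z hz => ?_⟩
    have h1 : f z = f₂ (optEmbed Pl z) := by
      have h2 := congr_arg (fun η : (ι → ℂ) [⋀^Fin 0]→L[ℝ] ℂ => η 0) (hF₂F₁ z)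
      simp only [flatPullback_apply, ContinuousAlternatingMap.compContinuousLinearMap_apply,
        hF₁f z (hKO' hz), hf0_def, hη₁, smul_constOfIsEmpty_one_apply] at h2
      rw [← h2]
      exact apply_eq_apply_zero_of_fin_zero _ _
    rw [h1]
    exact hφf _ (optEmbed_mem_analyticPolyhedron_opt hz)

/-! ### Hörmander's Theorem 2.7.8 on convex open subsets of `ℂ^ι` -/

/-- **`∂̄`-potentials on convex open subsets of `ℂ^ι`** (Hörmander (1973), Thm. 2.7.8 for convex
`Ω`): if `Ω ⊆ ℂ^ι` is open and convex and `α : ℂ^ι → Λ^{n+1}` is `C^∞` on `Ω`, of type `(p,q+1)`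
on `Ω`, with `(dα)^{p,q+2} = 0` on `Ω`, then `α = (dβ)^{p,q+1}` on `Ω` for some `β`, `C^∞` on `Ω`
and fixed by the `(p,q)`-projection. Proof: `Ω` is exhausted by compact affine polyhedra
(`exists_affinePolyhedron_exhaustion`), which have the Cousin property (Oka,
`exists_dbar_potential_nhdsSet_analyticPolyhedron`) and the entire-approximation property
(Oka–Weil, `entireApprox_analyticPolyhedron`); conclude by
`exists_dbar_potential_of_compactExhaustion`. [cite: HormanderSCV1973, Thm. 2.7.8] -/
theorem exists_dbar_potential_of_convex {ι : Type*} [Fintype ι] [DecidableEq ι]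
    {Ω : Set (ι → ℂ)} (hΩo : IsOpen Ω) (hΩc : Convex ℝ Ω)
    {n p q : ℕ} {α : (ι → ℂ) → (ι → ℂ) [⋀^Fin (n + 1)]→L[ℝ] ℂ} (hα : ContDiffOn ℝ ∞ α Ω)
    (htype : ∀ x ∈ Ω, IsOfTypeAt p (q + 1) (α x))
    (hclosed : ∀ x ∈ Ω, typeProjAt p (q + 2) (extDeriv α x) = 0) :
    ∃ β : (ι → ℂ) → (ι → ℂ) [⋀^Fin n]→L[ℝ] ℂ, ContDiffOn ℝ ∞ β Ω ∧
      (∀ x, typeProjAt p q (β x) = β x) ∧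
      ∀ x ∈ Ω, typeProjAt p (q + 1) (extDeriv β x) = α x := by
  obtain ⟨K, hKaff, hKc, hKΩ, hKmono, hΩK⟩ := exists_affinePolyhedron_exhaustion hΩo hΩc
  -- each `K j` is an analytic polyhedron for affine (entire) functions
  have hKan : ∀ j, ∃ (c : ι → ℂ) (r : ι → ℝ) (m : ℕ) (P : Fin m → (ι → ℂ) → ℂ),
      (∀ l, Differentiable ℂ (P l)) ∧ K j = analyticPolyhedron c r P := by
    intro j
    obtain ⟨c, r, m, L, b, -, hKj⟩ := hKaff j
    refine ⟨c, r, m, fun l z => L l z + b l, fun l => (L l).differentiable.add_const _, ?_⟩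
    rw [hKj]
    rfl
  refine exists_dbar_potential_of_compactExhaustion hΩo hKc hKΩ hKmono hΩK ?_ ?_ hα htype hclosed
  · intro j n p q W hWo hKW f hf hft hfc
    obtain ⟨c, r, m, P, hP, hKj⟩ := hKan j
    rw [hKj] at hKW ⊢
    exact exists_dbar_potential_nhdsSet_analyticPolyhedron c r P hP hWo hKW hf hft hfc
  · intro j W hWo hKW h hh ε hε
    obtain ⟨c, r, m, P, hP, hKj⟩ := hKan j
    rw [hKj] at hKW ⊢
    exact entireApprox_analyticPolyhedron m c r P hP hWo hKW hh hε

/-! ### The convex case of the `∂̄`-Poincaré lemma -/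

/-- **`H^{p,q+1}_{∂̄}(U) = 0` for convex open `U ⊆ ℂ^ι`** (Hörmander (1973), Thm. 2.7.8 /
Cor. 4.2.6 for convex sets; the case `E = ℂ^ι` of
`Literature.NumberTheory.Transcendental.subsingleton_dolbeaultCohomology_of_convex`).
[cite: HormanderSCV1973, Thm. 2.7.8] -/
theorem subsingleton_dolbeaultCohomology_of_convex_pi {ι : Type*} [Fintype ι] [DecidableEq ι]
    (U : TopologicalSpace.Opens (ι → ℂ)) (hU : Convex ℝ (U : Set (ι → ℂ))) (p q : ℕ) :
    Subsingleton (dolbeaultCohomology (ι → ℂ) U p (q + 1)) :=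
  subsingleton_dolbeaultCohomology_of_flatDbarSolver fun _ hα ht hc =>
    exists_dbar_potential_of_convex U.isOpen hU hα ht hc

variable {E : Type*} [NormedAddCommGroup E] [NormedSpace ℂ E]

/-- **The `∂̄`-Poincaré (Dolbeault–Grothendieck) lemma on convex open sets**: discharge of the
named fact `Literature.NumberTheory.Transcendental.subsingleton_dolbeaultCohomology_of_convex` —
for `E` a finite-dimensional complex normed space, `U ⊆ E` open and convex and all `p, q`,
`H^{p,q+1}_{∂̄}(U) = 0` (Hörmander (1973), Cor. 4.2.6 / Thm. 2.7.8 for convex `Ω`, here by the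
elementary Ch. II route: polydisc lemma 2.3.3, Oka's Lemma 2.7.5 / Thm. 2.7.6, Oka–Weil 2.7.7,
exhaustion 2.7.8; transported from `ℂⁿ` along a complex-linear homeomorphism `E ≃ ℂⁿ`). The
polydisc case is Voisin (2002), Prop. 2.36. [cite: HormanderSCV1973, Thm. 2.7.8]
[cite: Voisin2002, Prop. 2.36] -/
theorem subsingleton_dolbeaultCohomology_of_convex_holds :
    subsingleton_dolbeaultCohomology_of_convex (E := E) := by
  intro _ U hU p q
  have hd : Module.finrank ℂ E = Module.finrank ℂ (Fin (Module.finrank ℂ E) → ℂ) := by simp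
  set Φ : E ≃L[ℂ] (Fin (Module.finrank ℂ E) → ℂ) := ContinuousLinearEquiv.ofFinrankEq hd with hΦ
  set V : TopologicalSpace.Opens (Fin (Module.finrank ℂ E) → ℂ) :=
    ⟨(Φ.symm : (Fin (Module.finrank ℂ E) → ℂ) → E) ⁻¹' (U : Set E),
      U.isOpen.preimage Φ.symm.continuous⟩ with hV
  have hUV : ∀ x, x ∈ U ↔ Φ x ∈ V := fun x => by
    change x ∈ U ↔ Φ.symm (Φ x) ∈ (U : Set E)
    rw [Φ.symm_apply_apply]
    rfl
  have hVc : Convex ℝ (V : Set (Fin (Module.finrank ℂ E) → ℂ)) :=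
    hU.linear_preimage
      (((Φ.symm : (Fin (Module.finrank ℂ E) → ℂ) →L[ℂ] E).restrictScalars ℝ).toLinearMap)
  exact subsingleton_dolbeaultCohomology_of_equiv_preimage Φ hUV
    (subsingleton_dolbeaultCohomology_of_convex_pi V hVc p q)

end Literature.NumberTheory.Transcendental
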